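import Summits.ValiantsHypothesis.ValiantsHypothesis.Theorems.KPlusLogSqLawTropicalPermutationChanges

/-!
# Route «KPlusLogSqLaw», cruxes `WeakLifting` / `TropicalB` — structure lemma: the RE-ENTRY LAW
# «a dominant chain that never re-enters an entry position has at most `K·m²` steps»

HONEST FRAMING.  Helper file (cell `pub-symmetroid`, seat val-sym-lift-p3 g4, 2026-08-27) toward the crux
`Summit.ValiantsHypothesis.ValiantsHypothesis.Theses.KPlusLogSqLaw.WeakLifting` (ledger item `stmt-ValiantsHypothesis-19561`;
docket D2 = the `K = 4` tropical exponent fork) in the dominance vocabulary of `…CensusTropicalKLaw` (`TropRootLawAt`, `IsDominant`,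
`termSign`).  A STRUCTURAL inequality for dominant chains of an arbitrary design of any format `(m, K)`; it proves no stub and asserts
nothing about `TropicalB`, `WeakLifting`, `Lifting`, `KPlusLogSqLaw`, `MatrixDescartes` (stmt-ValiantsHypothesis-18050) or `VP ≠ VNP`.

THE LAW (`le_of_singleTenure`).  Let `p₀, …, pₙ` (`pₖ = (σₖ, λₖ)`) be unique optima at strictly increasing integer slopes with
alternating signs (the hypothesis list of `TropRootLawAt`).  Say the chain has SINGLE TENURE if every entry position `(a, i)` is used
along an interval of chain positions: `σ_{k₁} i = a = σ_{k₃} i` and `k₁ ≤ k₂ ≤ k₃` force `σ_{k₂} i = a` (no position is left and later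
re-entered).  Then

  `n ≤ m · m · K`.

Proof: a step `k → k+1` changes the (row, class) datum of some column `i`; map the step to the triple (row `σₖ i`, column `i`,
class `λₖ i`) it abandons there.  The map is injective: if steps `k < k'` abandoned the same triple, then position `(σₖ i, i)` is used at
`k` and at `k'`, hence (single tenure) at `k+1`; so step `k` kept the position and changed the class at `i`, and entrywise exponent
monotonicity along the uses of an entry (`d_lt_of_dominant_entry`, tree) gives `d (λₖ i) < d (λₖ₊₁ i) ≤ d (λ_{k'} i) = d (λₖ i)` —
absurd (the middle inequality is strict or an equality of classes, both contradictory).  So `n ≤ |Fin m × Fin m × Fin K|`.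

READING for the D2 fork (located consequence, not a claim about `T(m,4)`): the tree's budget `n ≤ P + m²(K−1)` (`le_permChanges_add`,
`P` = permutation-changing steps) says a cubic `K = 4` family changes its permutation `Θ(m³)` times; the present law adds that it must
RE-ENTER entry positions — a design all of whose entries are held during one slope-interval each (in particular every design admitting
dual potentials convex in the slope) has `≤ 4m²` alternations; along a cubic family the average used position is left and re-entered
`Ω(m)` times.  [folklore exchange/threshold reasoning for parametric assignment; this packaging is the cell's]
-/

set_option linter.dupNamespace false
set_option autoImplicit false

namespace Summit.ValiantsHypothesis.ValiantsHypothesis.Theorems.LacunarySymmetroidMatrixDescartes.TropicalCensus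

open Summit.ValiantsHypothesis.ValiantsHypothesis.Theorems.MatrixDescartes.Negative
open scoped BigOperators
open Finset

section Reentry

variable {m K : ℕ}

/-- **Re-entry law.**  A dominant sign-alternating chain at strictly increasing slopes in which every entry position `(a, i)` is
used along an INTERVAL of chain positions (`σ_{k₁} i = σ_{k₃} i = a`, `k₁ ≤ k₂ ≤ k₃ ⇒ σ_{k₂} i = a`) has at most `m·m·K` steps:
each step abandons a (row, column, class) triple that is never abandoned again. [folklore] -/
theorem le_of_singleTenure (d : Fin K → ℕ) (v ε : Fin m → Fin m → Fin K → ℤ) (n : ℕ)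
    (θ : Fin (n + 1) → ℤ) (p : Fin (n + 1) → Equiv.Perm (Fin m) × (Fin m → Fin K)) (hθ : StrictMono θ)
    (hdom : ∀ k, IsDominant d v ε (θ k) (p k))
    (halt : ∀ k : Fin n, termSign ε (p k.castSucc) * termSign ε (p k.succ) < 0)
    (hten : ∀ (i : Fin m) (k₁ k₂ k₃ : Fin (n + 1)), k₁ ≤ k₂ → k₂ ≤ k₃ →
      (p k₁).1 i = (p k₃).1 i → (p k₂).1 i = (p k₁).1 i) :
    n ≤ m * m * K := by
  classical
  have hinj : Function.Injective p := stub_dominantInjective m K d v ε n θ p hθ hdom halt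
  -- every step changes the (row, class) datum of some column
  have hchg : ∀ k : Fin n, ∃ i : Fin m,
      ((p k.castSucc).1 i, (p k.castSucc).2 i) ≠ ((p k.succ).1 i, (p k.succ).2 i) := by
    intro k
    by_contra hno
    push Not at hno
    have heq : p k.castSucc = p k.succ := by
      refine Prod.ext (Equiv.ext fun i => ?_) (funext fun i => ?_)
      · exact (Prod.mk.inj (hno i)).1
      · exact (Prod.mk.inj (hno i)).2
    have := hinj heq
    exact (Fin.castSucc_lt_succ (i := k)).ne (by rw [this])
  choose col hcol using hchg
  -- the abandoned triple of a step
  let f : Fin n → Fin m × Fin m × Fin K :=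
    fun k => ((p k.castSucc).1 (col k), col k, (p k.castSucc).2 (col k))
  have hf : Function.Injective f := by
    intro k k' hkk'
    -- unpack equality of triples
    have hc : col k = col k' := (Prod.mk.inj (Prod.mk.inj hkk').2).1
    have hrow : (p k.castSucc).1 (col k) = (p k'.castSucc).1 (col k') := (Prod.mk.inj hkk').1
    have hcls : (p k.castSucc).2 (col k) = (p k'.castSucc).2 (col k') := (Prod.mk.inj (Prod.mk.inj hkk').2).2
    -- wlog k ≤ k' by symmetry of the argument: prove a one-directional claim
    have key : ∀ a b : Fin n, a < b → col a = col b →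
        (p a.castSucc).1 (col a) = (p b.castSucc).1 (col b) →
        (p a.castSucc).2 (col a) = (p b.castSucc).2 (col b) → False := by
      intro a b hab hcab hr hcl
      set i := col a with hi_def
      rw [← hcab] at hr hcl
      -- chain positions: a.castSucc < a.succ ≤ b.castSucc
      have h12 : a.castSucc ≤ a.succ := (Fin.castSucc_lt_succ (i := a)).le
      have h23 : a.succ ≤ b.castSucc := by
        rw [Fin.le_def, Fin.val_succ, Fin.val_castSucc]; exact hab
      -- single tenure: the position is also used at a.succ
      have hmid : (p a.succ).1 i = (p a.castSucc).1 i := hten i _ _ _ h12 h23 hr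
      -- so the step a changed the class at column i
      have hne := hcol a
      rw [← hi_def] at hne
      have hcl1 : (p a.castSucc).2 i ≠ (p a.succ).2 i := by
        intro h; exact hne (by rw [hmid, h])
      -- exponent strictly up across the step (same entry)
      have hd1 : d ((p a.castSucc).2 i) < d ((p a.succ).2 i) :=
        d_lt_of_dominant_entry d v ε (hθ (Fin.castSucc_lt_succ (i := a))) _ _ _ _ (hdom _) (hdom _) i
          hmid.symm hcl1
      -- and not down from a.succ to b.castSucc (same entry again)
      rcases h23.eq_or_lt with h | h
      · have : (p a.succ).2 i = (p b.castSucc).2 i := by rw [h]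
        rw [this, ← hcl] at hd1
        exact lt_irrefl _ hd1
      · by_cases hc2 : (p a.succ).2 i = (p b.castSucc).2 i
        · rw [hc2, ← hcl] at hd1; exact lt_irrefl _ hd1
        · have hd2 : d ((p a.succ).2 i) < d ((p b.castSucc).2 i) :=
            d_lt_of_dominant_entry d v ε (hθ h) _ _ _ _ (hdom _) (hdom _) i (by rw [hmid, hr]) hc2
          rw [← hcl] at hd2
          exact lt_irrefl _ (hd1.trans hd2)
    rcases lt_trichotomy k k' with h | h | h
    · exact (key k k' h hc hrow hcls).elim
    · exact h
    · exact (key k' k h hc.symm hrow.symm hcls.symm).elim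
  have hcard := Fintype.card_le_of_injective f hf
  simpa [Fintype.card_fin, Fintype.card_prod, mul_assoc] using hcard

end Reentry

end Summit.ValiantsHypothesis.ValiantsHypothesis.Theorems.LacunarySymmetroidMatrixDescartes.TropicalCensus
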